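import Summits.QuantumFields.YangMills.Theorems.EquipartitionCriticalityEquipartitionPinsProbeTangentEnergyAlgebra
import Summits.QuantumFields.YangMills.Theorems.EquipartitionCriticalityEquipartitionPinsProbeTangentFieldMoments
import Mathlib.Analysis.SpecialFunctions.Exponential
import Mathlib.Analysis.Normed.Algebra.MatrixExponential
import HarnessLib

/-!
# Derivative of the rescaled plaquette field along a one-link shift: basic calculus

Crux `stmt-QuantumFields-8760` (`EquipartitionPinsProbe`), line `Sketch`, stub `stub_shiftDerivField`
(TS3) of the reshaped `stub_tangentCore` — the generic ingredients, assembled into the stub by the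
companion file `…TangentShiftDerivField`:

* the lattice curl `plaquetteCurl`: linearity, exactness on gradients (`d(ds) = 0`: the four corner
  values cancel), Cauchy–Schwarz `(dA)_p² ≤ 4 Σ_i A(∂_i p)²`, and term-wise differentiation;
* the Frobenius coordinate `M ↦ Re tr(M e_a†)`: real homogeneity, the chain rule through it (a
  continuous real-linear functional on the finite-dimensional `M_N(ℂ)`), `d/dt exp(tX)|₀ = X` for the
  curve `t ↦ exp((t : ℂ) • X)` (Mathlib's `hasDerivAt_exp_smul_const'` in the scoped Frobenius normed
  algebra; the complex scalar of a real number acts as the real scalar, definitionally), the product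
  rule for `t ↦ P_t V Q_t`, and the expansion of `Re tr((s₁XV − s₂VX) e_a†)` around `V = 1`;
* for a one-parameter subgroup `ρ(k_t) = exp(t e_b)`: `ρ(k_t⁻¹) = ρ(k_t)† = exp(−t e_b)` (`ρ` unitary,
  `e_b` skew-Hermitian), the derivatives at `0` of the optional shifts `ρ(k_t^{[P]})^{±1}`
  (`[P] ∈ {0, 1}` the indicator of a decidable proposition), the per-link derivative
  `d/dt Re tr((ρ(k_t^{[P]} g k_t^{−[Q]}) − 1) e_a†)|₀ = ([P] − [Q]) δ_ab + err`,
  `err = [P] Re tr(e_b (V−1) e_a†) − [Q] Re tr((V−1) e_b e_a†)`, `V = ρ(g)`, and the bound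
  `err² ≤ 8 (N − Re tr V)` (`|Re tr(M e_a†)| ≤ ‖M‖_F`, `‖e_b‖_F = 1`, `‖V − 1‖_F² = 2 (N − Re tr V)`).

References: S. Chatterjee, arXiv:1602.01222, §§9–11; B. C. Hall, GTM 222 (2015), Thm. 3.20.
-/

noncomputable section

open scoped Matrix Matrix.Norms.Frobenius
open Literature.Probability.LatticeModels Literature.MathematicalPhysics.QuantumLattice
open Literature.MathematicalPhysics.QuantumFieldTheory

namespace Summit.QuantumFields.YangMills.Theorems.EquipartitionPinsProbe

namespace TangentShiftDerivField

/-! ### The lattice curl: linearity, exactness on gradients, Cauchy–Schwarz, differentiation -/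

section Curl

/-- The curl of a linear combination `c (d A + B)` of `1`-cochains. -/
theorem plaquetteCurl_linComb (c d : ℝ) (A B : Literature.MathematicalPhysics.QuantumLattice.ZdEdge 4 → ℝ)
    (p : ZdPlaquette 4) :
    plaquetteCurl (fun e => c * (A e * d + B e)) p = c * (d * plaquetteCurl A p + plaquetteCurl B p) := by
  simp only [plaquetteCurl, Finset.mul_sum, ← Finset.sum_add_distrib]
  exact Finset.sum_congr rfl fun i _ => by ring

/-- The curl is additive. -/
theorem plaquetteCurl_add (A B : Literature.MathematicalPhysics.QuantumLattice.ZdEdge 4 → ℝ) (p : ZdPlaquette 4) :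
    plaquetteCurl (fun e => A e + B e) p = plaquetteCurl A p + plaquetteCurl B p := by
  simp only [plaquetteCurl, mul_add, Finset.sum_add_distrib]

/-- The curl of a difference. -/
theorem plaquetteCurl_sub (A B : Literature.MathematicalPhysics.QuantumLattice.ZdEdge 4 → ℝ) (p : ZdPlaquette 4) :
    plaquetteCurl (fun e => A e - B e) p = plaquetteCurl A p - plaquetteCurl B p := by
  simp only [plaquetteCurl, mul_sub, Finset.sum_sub_distrib]

/-- The curl of a negative. -/
theorem plaquetteCurl_neg (A : Literature.MathematicalPhysics.QuantumLattice.ZdEdge 4 → ℝ) (p : ZdPlaquette 4) :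
    plaquetteCurl (fun e => -A e) p = -plaquetteCurl A p := by
  simp only [plaquetteCurl, mul_neg, Finset.sum_neg_distrib]

/-- **Exactness `d ∘ d = 0` in degree one**: the curl of a gradient `(ds)(y, j) = s(y + e_j) − s(y)`
vanishes on every plaquette (the four values of `s` at the corners cancel in pairs). -/
theorem plaquetteCurl_gradient (s : Site 4 → ℝ) (p : ZdPlaquette 4) :
    plaquetteCurl (fun e => s (e.1 + Pi.single e.2 1) - s e.1) p = 0 := by
  rw [plaquetteCurl_eq]
  simp only
  rw [add_right_comm p.1 (Pi.single p.2.1.2 1) (Pi.single p.2.1.1 1)]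
  ring

/-- Cauchy–Schwarz for the four signed boundary terms: `(dA)_p² ≤ 4 Σ_i A(∂_i p)²`. -/
theorem plaquetteCurl_sq_le (A : Literature.MathematicalPhysics.QuantumLattice.ZdEdge 4 → ℝ) (p : ZdPlaquette 4) :
    (plaquetteCurl A p) ^ 2 ≤ 4 * ∑ i : Fin 4, (A (plaquetteBoundary p i)) ^ 2 := by
  simp only [plaquetteCurl, Fin.sum_univ_four, plaquetteBoundarySign, Matrix.cons_val_zero,
    Matrix.cons_val_one, Matrix.cons_val]
  nlinarith [sq_nonneg (A (plaquetteBoundary p 0) - A (plaquetteBoundary p 1)),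
    sq_nonneg (A (plaquetteBoundary p 0) + A (plaquetteBoundary p 2)),
    sq_nonneg (A (plaquetteBoundary p 0) + A (plaquetteBoundary p 3)),
    sq_nonneg (A (plaquetteBoundary p 1) + A (plaquetteBoundary p 2)),
    sq_nonneg (A (plaquetteBoundary p 1) + A (plaquetteBoundary p 3)),
    sq_nonneg (A (plaquetteBoundary p 2) - A (plaquetteBoundary p 3))]

/-- Differentiation commutes with the (finite, linear) curl. -/
theorem hasDerivAt_plaquetteCurl {A : ℝ → Literature.MathematicalPhysics.QuantumLattice.ZdEdge 4 → ℝ}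
    {A' : Literature.MathematicalPhysics.QuantumLattice.ZdEdge 4 → ℝ} {t : ℝ}
    (h : ∀ e, HasDerivAt (fun s => A s e) (A' e) t) (p : ZdPlaquette 4) :
    HasDerivAt (fun s => plaquetteCurl (A s) p) (plaquetteCurl A' p) t := by
  unfold plaquetteCurl
  exact HasDerivAt.fun_sum fun i _ => (h _).const_mul _

end Curl

/-! ### Frobenius coordinates: linearity, the chain rule, the exponential -/

section Lie

variable {G : Type} [Group G] [TopologicalSpace G] (r : LatticeRep G)

/-- Real homogeneity of the frame coordinates. -/
theorem lieCoord_smul (c : ℝ) (M : Matrix (Fin r.N) (Fin r.N) ℂ) (a : Fin (lieDim r)) :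
    lieCoord r (c • M) a = c * lieCoord r M a := by
  simp only [lieCoord, Matrix.smul_mul, Matrix.trace_smul, Complex.real_smul, Complex.re_ofReal_mul]

/-- Chain rule through the frame coordinate (a continuous real-linear functional on `M_N(ℂ)`):
`d/dt Re tr(M_t e_a†) = Re tr(M'_t e_a†)`. -/
theorem hasDerivAt_lieCoord {M : ℝ → Matrix (Fin r.N) (Fin r.N) ℂ} {M' : Matrix (Fin r.N) (Fin r.N) ℂ}
    {t : ℝ} (h : HasDerivAt M M' t) (a : Fin (lieDim r)) :
    HasDerivAt (fun s => lieCoord r (M s) a) (lieCoord r M' a) t :=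
  (LinearMap.toContinuousLinearMap
    ({ toFun := fun M => lieCoord r M a
       map_add' := fun M M' => TangentEnergyAlgebra.lieCoord_add r M M' a
       map_smul' := fun c M => by rw [RingHom.id_apply, smul_eq_mul]; exact lieCoord_smul r c M a } :
      Matrix (Fin r.N) (Fin r.N) ℂ →ₗ[ℝ] ℝ)).hasFDerivAt.comp_hasDerivAt t h

/-- `d/dt exp(tX)|₀ = X` for the curve `t ↦ exp((t : ℂ) • X)` (the real action, written with a complex scalar). -/
theorem hasDerivAt_exp_smul (X : Matrix (Fin r.N) (Fin r.N) ℂ) :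
    HasDerivAt (fun t : ℝ => NormedSpace.exp ((t : ℂ) • X)) X 0 := by
  have h := hasDerivAt_exp_smul_const' (𝕂 := ℝ) X (0 : ℝ)
  simp only [zero_smul, NormedSpace.exp_zero, mul_one] at h
  exact h

/-- Product rule for `t ↦ P_t V Q_t` at `t = 0` with `P_0 = Q_0 = 1`. -/
theorem hasDerivAt_mul_mul {P Q : ℝ → Matrix (Fin r.N) (Fin r.N) ℂ} {P' Q' : Matrix (Fin r.N) (Fin r.N) ℂ}
    (V : Matrix (Fin r.N) (Fin r.N) ℂ)
    (hP : HasDerivAt P P' 0) (hP0 : P 0 = 1) (hQ : HasDerivAt Q Q' 0) (hQ0 : Q 0 = 1) :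
    HasDerivAt (fun t => P t * V * Q t) (P' * V + V * Q') 0 := by
  have h := (hP.mul_const V).fun_mul hQ
  simp only [hP0, hQ0, mul_one, one_mul] at h
  exact h

/-- Expansion of the derivative coordinate around `V = 1`: `Re tr((s₁XV − s₂VX) e_a†) =
(s₁ − s₂) Re tr(X e_a†) + [s₁ Re tr(X(V−1) e_a†) − s₂ Re tr((V−1)X e_a†)]`. -/
theorem lieCoord_deriv_expand (s₁ s₂ : ℝ) (X V : Matrix (Fin r.N) (Fin r.N) ℂ) (a : Fin (lieDim r)) :
    lieCoord r ((s₁ • X) * V + V * -(s₂ • X)) a =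
      (s₁ - s₂) * lieCoord r X a + (s₁ * lieCoord r (X * (V - 1)) a - s₂ * lieCoord r ((V - 1) * X) a) := by
  have e1 : (s₁ • X) * V = s₁ • X + s₁ • (X * (V - 1)) := by
    rw [smul_mul_assoc, ← smul_add, mul_sub, mul_one]; abel
  have e2 : V * -(s₂ • X) = -(s₂ • X + s₂ • ((V - 1) * X)) := by
    rw [mul_neg, mul_smul_comm, ← smul_add, sub_mul, one_mul]; abel
  rw [e1, e2]
  simp only [TangentEnergyAlgebra.lieCoord_add, TangentEnergyAlgebra.lieCoord_neg, lieCoord_smul]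
  ring

end Lie

/-! ### The one-parameter subgroup `k_t` through `ρ`, the per-link derivative and its error -/

section Rep

variable {G : Type} [Group G] [TopologicalSpace G] (r : LatticeRep G) (b : Fin (lieDim r)) {k : ℝ → G}

/-- **Error bound**: for `|s₁|, |s₂| ≤ 1` and the unitary `V = ρ(g)`,
`(s₁ Re tr(e_b(V−1) e_a†) − s₂ Re tr((V−1)e_b e_a†))² ≤ (2‖V − 1‖_F)² = 8 (N − Re tr V)`. -/
theorem err_sq_le {s₁ s₂ : ℝ} (h₁ : |s₁| ≤ 1) (h₂ : |s₂| ≤ 1) (g : G) (a : Fin (lieDim r)) :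
    (s₁ * lieCoord r (lieVec r b * (r.ρ g - 1)) a - s₂ * lieCoord r ((r.ρ g - 1) * lieVec r b) a) ^ 2 ≤
      8 * ((r.N : ℝ) - (r.ρ g).trace.re) := by
  have hn : ‖r.ρ g - 1‖ ^ 2 = 2 * ((r.N : ℝ) - (r.ρ g).trace.re) :=
    TangentCombPoincare.norm_sub_one_sq (r.mem_unitary g)
  have hc₁ : |lieCoord r (lieVec r b * (r.ρ g - 1)) a| ≤ ‖r.ρ g - 1‖ :=
    (TangentEnergyAlgebra.abs_lieCoord_le r _ a).trans
      ((norm_mul_le _ _).trans_eq (by rw [TangentEnergyAlgebra.norm_lieVec, one_mul]))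
  have hc₂ : |lieCoord r ((r.ρ g - 1) * lieVec r b) a| ≤ ‖r.ρ g - 1‖ :=
    (TangentEnergyAlgebra.abs_lieCoord_le r _ a).trans
      ((norm_mul_le _ _).trans_eq (by rw [TangentEnergyAlgebra.norm_lieVec, mul_one]))
  have e₁ : |s₁ * lieCoord r (lieVec r b * (r.ρ g - 1)) a| ≤ ‖r.ρ g - 1‖ := by
    rw [abs_mul]; exact (mul_le_mul h₁ hc₁ (abs_nonneg _) zero_le_one).trans_eq (one_mul _)
  have e₂ : |s₂ * lieCoord r ((r.ρ g - 1) * lieVec r b) a| ≤ ‖r.ρ g - 1‖ := by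
    rw [abs_mul]; exact (mul_le_mul h₂ hc₂ (abs_nonneg _) zero_le_one).trans_eq (one_mul _)
  have hab : |s₁ * lieCoord r (lieVec r b * (r.ρ g - 1)) a - s₂ * lieCoord r ((r.ρ g - 1) * lieVec r b) a| ≤
      2 * ‖r.ρ g - 1‖ :=
    (abs_sub _ _).trans (by linarith)
  calc (s₁ * lieCoord r (lieVec r b * (r.ρ g - 1)) a - s₂ * lieCoord r ((r.ρ g - 1) * lieVec r b) a) ^ 2
      = |s₁ * lieCoord r (lieVec r b * (r.ρ g - 1)) a - s₂ * lieCoord r ((r.ρ g - 1) * lieVec r b) a| ^ 2 :=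
        (sq_abs _).symm
    _ ≤ (2 * ‖r.ρ g - 1‖) ^ 2 := pow_le_pow_left₀ (abs_nonneg _) hab 2
    _ = 8 * ((r.N : ℝ) - (r.ρ g).trace.re) := by rw [mul_pow, hn]; ring

variable (hk : ∀ t : ℝ, r.ρ (k t) = NormedSpace.exp ((t : ℂ) • lieVec r b))
include hk

/-- `ρ(k_0) = 1`. -/
theorem rho_k_zero : r.ρ (k 0) = 1 := by
  rw [hk, Complex.ofReal_zero, zero_smul, NormedSpace.exp_zero]

/-- `d/dt ρ(k_t)|₀ = e_b`. -/
theorem hasDerivAt_rho_k : HasDerivAt (fun t => r.ρ (k t)) (lieVec r b) 0 := by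
  have hfun : (fun t => r.ρ (k t)) = fun t : ℝ => NormedSpace.exp ((t : ℂ) • lieVec r b) := funext hk
  rw [hfun]
  exact hasDerivAt_exp_smul r (lieVec r b)

/-- `ρ(k_t⁻¹) = ρ(k_t)† = exp(t(−e_b))` (`ρ` unitary, `e_b` skew-Hermitian). -/
theorem rho_k_inv (t : ℝ) : r.ρ (k t)⁻¹ = NormedSpace.exp ((t : ℂ) • (-lieVec r b)) := by
  have hX : (lieVec r b)ᴴ = -lieVec r b := FreeEnergyLogCoefficient.conjTranspose_lieIso r.ρ _
  rw [TangentCombPoincare.map_inv_eq_conjTranspose r.ρ r.mem_unitary, hk, ← Matrix.exp_conjTranspose,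
    Matrix.conjTranspose_smul, hX, Complex.star_def, Complex.conj_ofReal]

/-- `d/dt ρ(k_t⁻¹)|₀ = −e_b`. -/
theorem hasDerivAt_rho_k_inv : HasDerivAt (fun t => r.ρ (k t)⁻¹) (-lieVec r b) 0 := by
  have hfun : (fun t => r.ρ (k t)⁻¹) = fun t : ℝ => NormedSpace.exp ((t : ℂ) • (-lieVec r b)) :=
    funext (rho_k_inv r b hk)
  rw [hfun]
  exact hasDerivAt_exp_smul r (-lieVec r b)

/-- Derivative of the optional shift `ρ(k_t^{[P]})` at `0`: `[P] e_b`. -/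
theorem hasDerivAt_rho_ite (P : Prop) [Decidable P] :
    HasDerivAt (fun t => r.ρ (if P then k t else 1)) ((if P then (1 : ℝ) else 0) • lieVec r b) 0 := by
  by_cases hP : P
  · simp only [if_pos hP, one_smul]; exact hasDerivAt_rho_k r b hk
  · simp only [if_neg hP, map_one, zero_smul]; exact hasDerivAt_const 0 1

/-- Derivative of the inverse optional shift `ρ((k_t^{[P]})⁻¹)` at `0`: `−[P] e_b`. -/
theorem hasDerivAt_rho_ite_inv (P : Prop) [Decidable P] :
    HasDerivAt (fun t => r.ρ (if P then k t else 1)⁻¹) (-((if P then (1 : ℝ) else 0) • lieVec r b)) 0 := by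
  by_cases hP : P
  · simp only [if_pos hP, one_smul]; exact hasDerivAt_rho_k_inv r b hk
  · simp only [if_neg hP, inv_one, map_one, zero_smul, neg_zero]; exact hasDerivAt_const 0 1

/-- The optional shift is `1` at `t = 0`. -/
theorem rho_ite_zero (P : Prop) [Decidable P] : r.ρ (if P then k 0 else 1) = 1 := by
  split_ifs
  · exact rho_k_zero r b hk
  · exact map_one _

/-- The inverse optional shift is `1` at `t = 0`. -/
theorem rho_ite_inv_zero (P : Prop) [Decidable P] : r.ρ (if P then k 0 else 1)⁻¹ = 1 := by
  split_ifs
  · rw [TangentCombPoincare.map_inv_eq_conjTranspose r.ρ r.mem_unitary, rho_k_zero r b hk,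
      Matrix.conjTranspose_one]
  · rw [inv_one, map_one]

/-- **The per-link derivative**: for `g ∈ G`, `V = ρ(g)` and decidable `P, Q`,
`d/dt Re tr((ρ(k_t^{[P]} g (k_t^{[Q]})⁻¹) − 1) e_a†)|₀ = ([P] − [Q]) Re tr(e_b e_a†) +
[P] Re tr(e_b (V−1) e_a†) − [Q] Re tr((V−1) e_b e_a†)`. -/
theorem hasDerivAt_link (P Q : Prop) [Decidable P] [Decidable Q] (g : G) (a : Fin (lieDim r)) :
    HasDerivAt (fun t => lieCoord r (r.ρ ((if P then k t else 1) * g * (if Q then k t else 1)⁻¹) - 1) a)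
      (((if P then (1 : ℝ) else 0) - (if Q then (1 : ℝ) else 0)) * lieCoord r (lieVec r b) a +
        ((if P then (1 : ℝ) else 0) * lieCoord r (lieVec r b * (r.ρ g - 1)) a -
          (if Q then (1 : ℝ) else 0) * lieCoord r ((r.ρ g - 1) * lieVec r b) a)) 0 := by
  have h1 := hasDerivAt_mul_mul r (r.ρ g) (hasDerivAt_rho_ite r b hk P) (rho_ite_zero r b hk P)
    (hasDerivAt_rho_ite_inv r b hk Q) (rho_ite_inv_zero r b hk Q)
  have h2 := hasDerivAt_lieCoord r (h1.sub_const 1) a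
  simp only [map_mul]
  exact h2.congr_deriv (lieCoord_deriv_expand r _ _ _ _ a)

end Rep

end TangentShiftDerivField

open TangentShiftDerivField in
/-- **Stub `stub_shiftDerivLink` (TS3a, anchor of this file)** of line `Sketch` (crux `stmt-QuantumFields-8760`):
the per-link derivative behind `stub_shiftDerivField` — for a one-parameter subgroup `ρ(k_t) = exp(t e_b)`,
decidable `P, Q`, `g ∈ G` and `V = ρ(g)`,
`d/dt Re tr((ρ(k_t^{[P]} g (k_t^{[Q]})⁻¹) − 1) e_a†)|₀ = ([P] − [Q]) Re tr(e_b e_a†) + err` with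
`err = [P] Re tr(e_b(V−1) e_a†) − [Q] Re tr((V−1)e_b e_a†)` and `err² ≤ 8 (N − Re tr V)`. -/
theorem stub_shiftDerivLink :
    ∀ (G : Type) [Group G] [TopologicalSpace G] (r : Literature.MathematicalPhysics.QuantumFieldTheory.LatticeRep G) (b : Fin (Summit.QuantumFields.YangMills.Theorems.EquipartitionPinsProbe.lieDim r)) (k : ℝ → G), (∀ t : ℝ, r.ρ (k t) = NormedSpace.exp ((t : ℂ) • Summit.QuantumFields.YangMills.Theorems.EquipartitionPinsProbe.lieVec r b)) → ∀ (P Q : Prop) [Decidable P] [Decidable Q] (g : G) (a : Fin (Summit.QuantumFields.YangMills.Theorems.EquipartitionPinsProbe.lieDim r)), HasDerivAt (fun t : ℝ => Summit.QuantumFields.YangMills.Theorems.EquipartitionPinsProbe.lieCoord r (r.ρ ((if P then k t else 1) * g * (if Q then k t else 1)⁻¹) - 1) a) (((if P then (1 : ℝ) else 0) - (if Q then (1 : ℝ) else 0)) * Summit.QuantumFields.YangMills.Theorems.EquipartitionPinsProbe.lieCoord r (Summit.QuantumFields.YangMills.Theorems.EquipartitionPinsProbe.lieVec r b) a + ((if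 P then (1 : ℝ) else 0) * Summit.QuantumFields.YangMills.Theorems.EquipartitionPinsProbe.lieCoord r (Summit.QuantumFields.YangMills.Theorems.EquipartitionPinsProbe.lieVec r b * (r.ρ g - 1)) a - (if Q then (1 : ℝ) else 0) * Summit.QuantumFields.YangMills.Theorems.EquipartitionPinsProbe.lieCoord r ((r.ρ g - 1) * Summit.QuantumFields.YangMills.Theorems.EquipartitionPinsProbe.lieVec r b) a)) 0 ∧ ((if P then (1 : ℝ) else 0) * Summit.QuantumFields.YangMills.Theorems.EquipartitionPinsProbe.lieCoord r (Summit.QuantumFields.YangMills.Theorems.EquipartitionPinsProbe.lieVec r b * (r.ρ g - 1)) a - (if Q then (1 : ℝ) else 0) * Summit.QuantumFields.YangMills.Theorems.EquipartitionPinsProbe.lieCoord r ((r.ρ g - 1) * Summit.QuantumFields.YangMills.Theorems.EquipartitionPinsProbe.lieVec r b) a) ^ 2 ≤ 8 * ((r.N : ℝ) - (r.ρ g).trace.re) := by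
  intro G _ _ r b k hk P Q _ _ g a
  exact ⟨hasDerivAt_link r b hk P Q g a,
    err_sq_le r b (by split_ifs <;> simp) (by split_ifs <;> simp) g a⟩

end Summit.QuantumFields.YangMills.Theorems.EquipartitionPinsProbe

end
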